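import Summits.QuantumFields.YangMills.Theorems.BalabanUVNodesN15TwoSpacingGluingNeumannKnitRightDefectCube
import Summits.QuantumFields.YangMills.Theorems.BalabanUVNodesN15TwoSpacingGluingNeumannKnitRightNonlocal
import Summits.QuantumFields.YangMills.Theorems.BalabanUVNodesN15NeumannCubeRightEntriesDefectClosed
import HarnessLib

/-!
# THE GLUING STEP AT TWO LATTICE SPACINGS, LVI: THE TWO-GRID η-DEFECT OF THE COVER's ADJOINT REMAINDER `𝔇(R̃′, R̃)`, HYPOTHESIS-FREE — the fourteenth row of FILE 50's bundle for the
# cover's glued `U ≡ 1` pair (dag-n15-c g13∕g14, FILE 98; N15 = NE2, s1 «background-layer OPERATOR ingredient»)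

Cell `pub-ymgap`, seat `pub-ymgap-dag-n15-c` (R134 (a); HUMAN RULING D-0062), generations 13–14.  `bears_on: R4∕N15 · K3⁸ SpineGivenEndpointR13SepCoPHV (stmt-QuantumFields-27366)`.
Filed `--supports stmt-QuantumFields-27366 --as helper` — COUNT-NEUTRAL.  Theorems only (0 `def`, 0 `sorry`).  Imports BY NAME FILE 97 `…NeumannKnitRightDefectCube` (★★★
`hasMaj_idef_chiCube_neumannCubeG_comp_commOp_deltaOp`: one cube's adjoint remainder row defect, local part proved, nonlocal part displayed; through it FILE 94 `hasMaj_chiCube_neumannCubeG_comp_commOp_deltaOp`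
∕ `remainderL_cut`, FILE 57 `hasMaj_idef_remainderL_out`, FILE 95 `rightRemainderConst_le` ∕ `maj₀_weaken` ∕ `maj₂_weaken`, FILES 65–70 cover ∕ partition ∕ `knitG` ∕ `knitH`, dag-n15-a's
`ineq110_114_pair`, `hasMaj_gOp_of_ineq`, `hasMaj_landauRe`, N-IIn `hasMaj_rightGrad_pair` ∕ `hasMaj_rightBgrad_pair` ∕ `hasMaj_idef_rightBgrad`, N-IIc `hasMaj_idef_chiCube_neumannCubeG`), FILE 100
`…NeumannKnitRightNonlocal` (★★★ `hasMaj_idef_chiCube_neumannCubeG_comp_commOp_nonlocal`: the nonlocal part's source-side defect, hypothesis-free via FILE 99's operator letter of `Q*Q`) and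
dag-n15-a N-IIr `…NeumannCubeRightEntriesDefectClosed` (★★★ `hasMaj_idef_rightGrad`: the (c)⁺ right-entry defect, binder-free since N-IIq `hasMaj_twoGridDefect_grad_fwd` landed); nothing in the
tree is modified.

WHY.  FILE 96 `ne2PlusOperator_knit_of_rightDefect` concludes `NE2PlusOperator c₃₅ (knitInstance hL θc θ) (knitFamily hL a θc θ)` — FILE 50's socket CALLED for the cover's glued `U ≡ 1` pair on
the doubled torus with `(gf i).M = L^m` LIVE — modulo ONE displayed row: the two-grid defect `𝔇(R̃′, R̃)` of the adjoint remainder `R̃ = Σ_k M_{h_k}(M_{χ_k}G(□_k))[Δ_a, M_{h_k}]` (FILE 94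
`remainderL_cut`).  FILE 57 `hasMaj_idef_remainderL_out` reduces it to the OUTPUT-localized per-cube defects `𝔇((M_{χ′}G′(□))∘[Δ′_a, M_{h′}], (M_χG(□))∘[Δ_a, M_h])` plus the coarse rows and the
partition's fit; FILE 97 proved the per-cube defect from the sandwiched right entries with two inputs displayed — the (c)⁺ right-entry defect's torus letter `hSrc` and the nonlocal part's
source-side defect `hDN`.  Both are now theorems: `hSrc` IS dag-n15-a N-IIq `hasMaj_twoGridDefect_grad_fwd` (fed through N-IIr), `hDN` IS FILE 100 (my WANT g13-2 (β), answered by FILE 99's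
two-grid operator letter of Bałaban's `Q*Q` on rough inputs).  So the fourteenth row is hypothesis-free.

WHAT.  §1 `mul3_le`, `mul3_le'`, ★ `rightDefectConst_le` (the per-cube defect constant is `≤ K·θ` once every rate carrier is `≤ θ`).  §2 `maj₁_weaken`, ★★★ **`hasMaj_idef_remainderL_knit (hL : Odd L ∧ 1 < L)
(ha : 0 < a)`**: there are `δ, γ > 0`, `r ≥ 0` with, for all `m`, `k ≥ 1` (`4 ≤ L^k`), `r′`, on the doubled torus `MP (paramsOf d L (m+1) k hL)`,
  `𝔇(R̃′, R̃) = 𝔇(remainderL Δ′_a h′ G′, remainderL Δ_a h G) ≤ r·(L^k)^{−γ}·e^{−δ|y−y′|_T}`,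
`γ = min(1∕16, 1∕(8(d+1)), 1, γ_N)` — NO displayed hypothesis.  CONSUMER: the next file calls FILE 96 with it: `NE2PlusOperator` BY NAME for the cover's glued `U ≡ 1` pair, NO displayed row.

HONEST FRAMING ∕ LIMITS.  Block-majorant bookkeeping over LANDED rows; `U ≡ 1` doubled-cube torus MODEL (cube = half torus: circular as an estimate); the (3.35) guard is consumed vacuously
downstream (entries independent of `U`) — NOT [B9]'s background-dependent pair; nothing of [B5]∕[B6] (2.38)–(2.40)∕[B9] Thm 3.1, 3.14 asserted ([B9] Thm 3.14 = difference TEMPLATE).  NE2⁺ NOT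
PRINTED, NOT proved; N15 NOT discharged; counts of record UNMOVED (typed 28∕28 · discharged 5∕27); one finite 𝕋⁴ at fixed ε per index — NOT infinite volume, NOT OS on ℝ⁴, NOT a mass gap,
NOT Clay; R4 closes `BalabanLadder.UV` only.  Restate-immune (no Theses import).
-/


noncomputable section

namespace Summit.QuantumFields.YangMills.BalabanUVNodes.N15.Gluing

open Literature.MathematicalPhysics.QuantumFieldTheory.Balaban1983to89
open Literature.MathematicalPhysics.QuantumFieldTheory.Balaban1983to89.B5Prop11Plancherel (Tor fine)
open Literature.MathematicalPhysics.QuantumFieldTheory.Balaban1983to89.B11SectG (BlockNorm HasMaj)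
open Literature.MathematicalPhysics.QuantumFieldTheory.Balaban1983to89.B6Prop26Gluing (mulOp ind ind_nonneg ind_le_one)
open Literature.MathematicalPhysics.QuantumFieldTheory.Balaban1983to89.T4EtaRate (NE2PlusOperator)
open Literature.MathematicalPhysics.QuantumFieldTheory.Balaban1983to89.T4EtaRateDefect (idef)
open Literature.MathematicalPhysics.QuantumFieldTheory.Balaban1983to89.T4EtaRateCoeffDefect (pull)
open Literature.MathematicalPhysics.QuantumFieldTheory.Balaban1983to89.B6UnitTorusCarrier (unitTorusGeo)
open Literature.MathematicalPhysics.QuantumFieldTheory.Balaban1983to89.B5SiteBridgeP12 (MP)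
open Literature.MathematicalPhysics.QuantumFieldTheory.King1986.Torus (blockOf tdistT tdistT_nonneg)
open Summit.QuantumFields.YangMills.BalabanUVNodes.N15.VectorPiece (bshiftEquiv kingPrV blkFine)
open Summit.QuantumFields.YangMills.BalabanUVNodes.N15.BackgroundLayer (fgrad fgradAdj bgrad symbOp_sD_eq symbOp_sTinv_sub_one_eq)
open Summit.QuantumFields.YangMills.BalabanUVNodes.N15.TwoGrid (paramsOf deltaOp gOp neumannCubeG symOp symbOp sD sTinv chiCube cubeBlocks landauRe qvRe qvAdjRe
  ineq110_114_pair hasMaj_gOp_of_ineq hasMaj_landauRe hasMaj_rightGrad_pair hasMaj_rightBgrad_pair hasMaj_idef_rightBgrad hasMaj_idef_rightGrad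
  hasMaj_idef_chiCube_neumannCubeG)

variable {d : ℕ}

/-! ## §1 The constants -/

section Consts

open Real

/-- A product of three factors in `[0,1] × [0,θ] × [0,A]`-style bounds: `u·ε·A ≤ θ·A` for `u ≤ 1`, `0 ≤ ε ≤ θ`, `0 ≤ A`. [folklore] -/
theorem mul3_le {u ε θ A : ℝ} (hu1 : u ≤ 1) (hε0 : 0 ≤ ε) (hε : ε ≤ θ) (hA : 0 ≤ A) : u * ε * A ≤ θ * A := by
  have h1 : u * ε ≤ 1 * θ := mul_le_mul hu1 hε hε0 zero_le_one
  rw [one_mul] at h1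
  exact mul_le_mul_of_nonneg_right h1 hA

/-- `m·ε·c ≤ m·θ·C` for `0 ≤ m`, `0 ≤ ε ≤ θ`, `0 ≤ c ≤ C`. [folklore] -/
theorem mul3_le' {m ε θ c C : ℝ} (hm : 0 ≤ m) (hε0 : 0 ≤ ε) (hε : ε ≤ θ) (hc0 : 0 ≤ c) (hc : c ≤ C) : m * ε * c ≤ m * θ * C :=
  mul_le_mul (mul_le_mul_of_nonneg_left hε hm) hc hc0 (mul_nonneg hm (hε0.trans hε))

/-- ★ **THE DEFECT CONSTANT IS UNIFORM**: FILE 97's cube-defect constant with `m_G = m_c·ε₁₆`, `m₁ = m_x·ε₈`, `r_N·ε_N`, the fits' `ε₁ = (L^k·w)⁻¹` and `w ≥ 1` is `≤ K·θ` as soon as every rate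
factor is `≤ θ`. [folklore] -/
theorem rightDefectConst_le {D β β₁ mc mx rN A₁ A₂ w ε₁ e16 e8 eN θ : ℝ} (hw : 1 ≤ w) (hD : 0 ≤ D) (hβ : 0 ≤ β) (hβ₁ : 0 ≤ β₁) (hmc : 0 ≤ mc) (hmx : 0 ≤ mx) (hrN : 0 ≤ rN)
    (hA₁ : 0 ≤ A₁) (hA₂ : 0 ≤ A₂) (hε₁0 : 0 ≤ ε₁) (hε₁ : ε₁ ≤ θ) (he16 : 0 ≤ e16) (he16' : e16 ≤ θ) (he8 : 0 ≤ e8) (he8' : e8 ≤ θ) (heN' : eN ≤ θ) :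
    D * (3 * (β * (w⁻¹ ^ 2 * ε₁ * A₂) + mc * e16 * (32 * π ^ 2 / w ^ 2)) + 2 * (β₁ * (|w⁻¹| * ε₁ * A₁) + mx * e8 * (π / w))) + 0 + rN * eN ≤
      (D * (3 * (β * A₂ + mc * (32 * π ^ 2)) + 2 * (β₁ * A₁ + mx * π)) + rN) * θ := by
  have hw0 : 0 < w := by linarith
  have hwi : w⁻¹ ≤ 1 := inv_le_one_of_one_le₀ hw
  have hwi0 : 0 ≤ w⁻¹ := inv_nonneg.mpr hw0.le
  have hwi2 : w⁻¹ ^ 2 ≤ 1 := by nlinarith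
  have habs : |w⁻¹| ≤ 1 := by rw [abs_of_nonneg hwi0]; exact hwi
  have hc2 : 32 * π ^ 2 / w ^ 2 ≤ 32 * π ^ 2 := div_le_self (by positivity) (by nlinarith)
  have hc1 : π / w ≤ π := div_le_self Real.pi_pos.le hw
  have t1 : w⁻¹ ^ 2 * ε₁ * A₂ ≤ θ * A₂ := mul3_le hwi2 hε₁0 hε₁ hA₂
  have t2 : mc * e16 * (32 * π ^ 2 / w ^ 2) ≤ mc * θ * (32 * π ^ 2) := mul3_le' hmc he16 he16' (by positivity) hc2
  have t3 : |w⁻¹| * ε₁ * A₁ ≤ θ * A₁ := mul3_le habs hε₁0 hε₁ hA₁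
  have t4 : mx * e8 * (π / w) ≤ mx * θ * π := mul3_le' hmx he8 he8' (by positivity) hc1
  have t5 : rN * eN ≤ rN * θ := mul_le_mul_of_nonneg_left heN' hrN
  have s1 : β * (w⁻¹ ^ 2 * ε₁ * A₂) ≤ β * (θ * A₂) := mul_le_mul_of_nonneg_left t1 hβ
  have s3 : β₁ * (|w⁻¹| * ε₁ * A₁) ≤ β₁ * (θ * A₁) := mul_le_mul_of_nonneg_left t3 hβ₁
  have sD : D * (3 * (β * (w⁻¹ ^ 2 * ε₁ * A₂) + mc * e16 * (32 * π ^ 2 / w ^ 2)) + 2 * (β₁ * (|w⁻¹| * ε₁ * A₁) + mx * e8 * (π / w))) ≤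
      D * (3 * (β * (θ * A₂) + mc * θ * (32 * π ^ 2)) + 2 * (β₁ * (θ * A₁) + mx * θ * π)) :=
    mul_le_mul_of_nonneg_left (by linarith) hD
  calc _ ≤ D * (3 * (β * (θ * A₂) + mc * θ * (32 * π ^ 2)) + 2 * (β₁ * (θ * A₁) + mx * θ * π)) + 0 + rN * θ := by linarith
    _ = (D * (3 * (β * A₂ + mc * (32 * π ^ 2)) + 2 * (β₁ * A₁ + mx * π)) + rN) * θ := by ring

end Consts

/-! ## §2 ★★★ The two-grid defect of the cover's adjoint remainder, hypothesis-free -/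

section Knit

open Real

/-- One-sided constant ∕ rate weakening. [folklore] -/
theorem maj₁_weaken {L : ℕ} {M : Fin (d + 1) → ℕ} [∀ μ, NeZero (M μ)] {kk : ℕ} {S : Set (Tor M)} {c C δ δ' : ℝ} (hc : c ≤ C) (hC : 0 ≤ C) (hδ : δ' ≤ δ) (y y' : Tor M) :
    ind (g := unitTorusGeo L kk M) S y * (c * Real.exp (-(δ * tdistT M y y'))) ≤ ind (g := unitTorusGeo L kk M) S y * (C * Real.exp (-(δ' * tdistT M y y'))) :=
  mul_le_mul_of_nonneg_left (mul_le_mul hc (Real.exp_le_exp.mpr (by nlinarith [tdistT_nonneg M y y'])) (Real.exp_nonneg _) hC) (ind_nonneg _ _)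

variable {L : ℕ} [NeZero L]

/-- ★★★ **THE TWO-GRID η-DEFECT OF THE COVER's ADJOINT REMAINDER, HYPOTHESIS-FREE.**  For odd `L ≥ 3`, `a > 0` there are `δ, γ > 0`, `r ≥ 0` with, for all `m`, `k ≥ 1` (`4 ≤ L^k`), `r′`,
on the doubled torus `MP (paramsOf d L (m+1) k hL)` with the cover's partition `h_k` and Neumann cubes `G(□_k)` at both spacings (King's pairing):
  `𝔇(R̃′, R̃) = 𝔇(remainderL Δ′_a h′ G′, remainderL Δ_a h G) ≤ r·(L^k)^{−γ}·e^{−δ|y−y′|_T}`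
— row 14 of FILE 50's bundle, the one displayed row of FILE 96.  FILE 97's cube defects fed with N-IIIb∕N-IIn (b)± fine rows, N-IIc, N-IIn (c)⁻ `hasMaj_idef_rightBgrad`, N-IIr (c)⁺
`hasMaj_idef_rightGrad` (binder-free; N-IIq's torus letter inside) and FILE 100's nonlocal source-side defect (FILE 99's operator letter of `Q*Q` inside); FILE 94's cube rows through FILE 57
`hasMaj_idef_remainderL_out` (overlap `(2L)^{d+1}`, `|h′| ≤ 1`, FILE 67's fit), FILE 94 `remainderL_cut` at both spacings; the rate factors `(L^k)^{−1∕16}`, `(L^k)^{−1∕(8(d+1))}`, `(L^k)^{−γ_N}`,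
`(L^k·L^m)^{−1}` are dominated by `(L^k)^{−γ}`, `γ = min(1∕16, 1∕(8(d+1)), 1, γ_N)` (`rightDefectConst_le`, FILE 95 `rightRemainderConst_le`).
[cite: Balaban1984PropagatorsII, (2.91)–(2.93) p.239, (2.133)–(2.136) p.247 (shapes + mechanism, transposed); Balaban1985BackgroundPropagators, Thm 3.14 pp.426–427 (difference template); King1986,
Prop. 3.9 (3.73) p.665 (rate factor)] -/
theorem hasMaj_idef_remainderL_knit (hL : Odd L ∧ 1 < L) {a : ℝ} (ha : 0 < a) :
    ∃ δ rr γ : ℝ, 0 < δ ∧ 0 ≤ rr ∧ 0 < γ ∧ ∀ (m kk r : ℕ) (_hk : 1 ≤ kk) (_hn4 : 4 ≤ L ^ kk),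
      HasMaj (BlockNorm.ofBlocks (unitTorusGeo L kk (MP (paramsOf d L (m + 1) kk hL)))
          (fun b : Tor (fine (L ^ kk) (MP (paramsOf d L (m + 1) kk hL))) × Fin (d + 1) => blockOf (L ^ kk) (MP (paramsOf d L (m + 1) kk hL)) b.1))
        (BlockNorm.ofBlocks (unitTorusGeo L kk (MP (paramsOf d L (m + 1) kk hL)))
          (fun x : Tor (fine (L ^ r * L ^ kk) (MP (paramsOf d L (m + 1) kk hL))) × Fin (d + 1) => blockOf (L ^ r * L ^ kk) (MP (paramsOf d L (m + 1) kk hL)) x.1))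
        (idef (pull (kingPrV L kk r (MP (paramsOf d L (m + 1) kk hL)))) (pull (kingPrV L kk r (MP (paramsOf d L (m + 1) kk hL))))
          (remainderL (deltaOp (MP (paramsOf d L (m + 1) kk hL)) (L ^ r * L ^ kk) a) (knitH d L m kk (L ^ r * L ^ kk) hL) (knitG d L m kk (L ^ r * L ^ kk) hL a))
          (remainderL (deltaOp (MP (paramsOf d L (m + 1) kk hL)) (L ^ kk) a) (knitH d L m kk (L ^ kk) hL) (knitG d L m kk (L ^ kk) hL a)))
        (fun y y' => rr * ((L : ℝ) ^ kk) ^ (-γ) * Real.exp (-(δ * tdistT (MP (paramsOf d L (m + 1) kk hL)) y y'))) := by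
  have hL3 : 3 ≤ L := by obtain ⟨⟨j, hj⟩, h1⟩ := hL; omega
  have hLpos : 0 < L := by omega
  have hL1 : 1 ≤ L := hLpos
  have hLodd : Odd L := hL.1
  have hL2 : 2 ≤ L := hL.2
  -- dag-n15-a's letters, N-IIr and FILE 100
  obtain ⟨δ₀, C, Cα, Cε, Cαε, hδ₀, hC, H⟩ := ineq110_114_pair (d := d) hL ha
  obtain ⟨δ₁, C₁, hδ₁, hC₁, HL⟩ := hasMaj_landauRe (d := d) (L := L)
  obtain ⟨δp, βp, hδp, hβp, HP⟩ := hasMaj_rightGrad_pair (d := d) hL ha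
  obtain ⟨δb, βb, hδb, hβb, HB⟩ := hasMaj_rightBgrad_pair (d := d) hL ha
  obtain ⟨δc, mc, hδc, hmc, HC⟩ := hasMaj_idef_chiCube_neumannCubeG (d := d) hLodd hL2 ha (γ := 1 / 8) (by norm_num) (by norm_num)
  obtain ⟨δib, mb, hδib, hmb, HIB⟩ := hasMaj_idef_rightBgrad (d := d) hLodd hL2 ha
  obtain ⟨δip, mp, hδip, hmp, HIP⟩ := hasMaj_idef_rightGrad (d := d) hLodd hL2 ha
  obtain ⟨δN, rN, γN, hδN, hrN, hγN, HN⟩ := hasMaj_idef_chiCube_neumannCubeG_comp_commOp_nonlocal (d := d) hL ha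
  -- one rate for the cube data, one constant for the right entries and their defects
  obtain ⟨δx, hδx_def⟩ : ∃ δx : ℝ, δx = min (min (min δ₀ δp) (min δb δc)) (min δib δip) := ⟨_, rfl⟩
  have hδx : 0 < δx := hδx_def ▸ lt_min (lt_min (lt_min hδ₀ hδp) (lt_min hδb hδc)) (lt_min hδib hδip)
  have dδ0 : δx ≤ δ₀ := hδx_def ▸ (min_le_left _ _).trans ((min_le_left _ _).trans (min_le_left _ _))
  have dδp : δx ≤ δp := hδx_def ▸ (min_le_left _ _).trans ((min_le_left _ _).trans (min_le_right _ _))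
  have dδb : δx ≤ δb := hδx_def ▸ (min_le_left _ _).trans ((min_le_right _ _).trans (min_le_left _ _))
  have dδc : δx ≤ δc := hδx_def ▸ (min_le_left _ _).trans ((min_le_right _ _).trans (min_le_right _ _))
  have dδib : δx ≤ δib := hδx_def ▸ (min_le_right _ _).trans (min_le_left _ _)
  have dδip : δx ≤ δip := hδx_def ▸ (min_le_right _ _).trans (min_le_right _ _)
  have hβx : 0 ≤ max βp βb := hβp.le.trans (le_max_left _ _)
  have hmx : 0 ≤ max mp mb := hmp.le.trans (le_max_left _ _)
  obtain ⟨ρ, hρ_def⟩ : ∃ ρ : ℝ, ρ = min (min δx δ₁ / 2) δN := ⟨_, rfl⟩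
  have hρ : 0 < ρ := hρ_def ▸ lt_min (by positivity) hδN
  have hρx : ρ ≤ δx := hρ_def ▸ (min_le_left _ _).trans (by linarith [min_le_left δx δ₁, hδx.le] : min δx δ₁ / 2 ≤ δx)
  have hρK : ρ ≤ min δx δ₁ / 2 := hρ_def ▸ min_le_left _ _
  have hρN : ρ ≤ δN := hρ_def ▸ min_le_right _ _
  obtain ⟨γ, hγ_def⟩ : ∃ γ : ℝ, γ = min (min (1 / 8 / 2) (1 / (8 * ((d : ℝ) + 1)))) (min 1 γN) := ⟨_, rfl⟩
  have hγ : 0 < γ := hγ_def ▸ lt_min (lt_min (by norm_num) (by positivity)) (lt_min one_pos hγN)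
  have hγ16 : γ ≤ 1 / 8 / 2 := hγ_def ▸ (min_le_left _ _).trans (min_le_left _ _)
  have hγ8 : γ ≤ 1 / (8 * ((d : ℝ) + 1)) := hγ_def ▸ (min_le_left _ _).trans (min_le_right _ _)
  have hγ1 : γ ≤ 1 := hγ_def ▸ (min_le_right _ _).trans (min_le_left _ _)
  have hγN' : γ ≤ γN := hγ_def ▸ (min_le_right _ _).trans (min_le_right _ _)
  have hcr : 0 ≤ B4Sect5Proof.latticeConst (d + 1) (min δx δ₁ / 4) := B4Sect5Proof.latticeConst_nonneg (d + 1) (by positivity)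
  have hNov : (0 : ℝ) ≤ (((2 * L) ^ (d + 1) : ℕ) : ℝ) := by positivity
  refine ⟨ρ, (((2 * L) ^ (d + 1) : ℕ) : ℝ) * ((Fintype.card (Fin (d + 1)) : ℝ) * (3 * (2 ^ (d + 1) * (C * Real.exp δx) * (144 * π ^ 3 + 32 * π ^ 3 * Fintype.card (Fin (d + 1))) + mc * (32 * π ^ 2)) + 2 * (max βp βb * (64 * π ^ 2 + π ^ 2 * Fintype.card (Fin (d + 1))) + max mp mb * π)) + rN + π * (d + 1) * (((d + 1 : ℕ) : ℝ) * (3 * (2 ^ (d + 1) * (C * Real.exp δx) * (32 * π ^ 2)) + 2 * (max βp βb * π)) + 2 ^ (d + 1) * (C * Real.exp δx) * ((π * ((d : ℝ) + 1) * (Real.exp 1 * (min δx δ₁ / 4))⁻¹ + 2 * (π * ((d : ℝ) + 1))) * (|a| * (Real.exp (min δx δ₁) * Real.exp (min δx δ₁)) + C₁)) * B4Sect5Proof.latticeConst (d + 1) (min δx δ₁ / 4))),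
    γ, hρ, by positivity, hγ, fun m kk r hk hn4 => ?_⟩
  · -- the index's data
    have hM : ∀ ν, MP (paramsOf d L (m + 1) kk hL) ν = 2 * L * L ^ m := MP_succ_eq L m kk hL
    have hw : 0 < L ^ m := pow_pos hLpos m
    have hn : 1 ≤ L ^ kk := Nat.one_le_pow _ _ hLpos
    have hn' : 1 ≤ L ^ r * L ^ kk := Nat.one_le_iff_ne_zero.mpr (Nat.mul_ne_zero (pow_ne_zero r (NeZero.ne L)) (pow_ne_zero kk (NeZero.ne L)))
    have hfit := coverMargin_fit hL3 m
    have hfit1 : coverMargin L m + 2 * L ^ m + 1 ≤ L * L ^ m := by omega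
    have hS : L * L ^ m ≤ 2 * L * L ^ m := by rw [mul_assoc]; omega
    have hSe : L ^ (m + 1) = L * L ^ m := by rw [pow_succ, mul_comm]
    have h3 : 3 ≤ L ^ kk * L ^ m :=
      calc 3 ≤ L := hL3
        _ = L ^ 1 := (pow_one L).symm
        _ ≤ L ^ kk := Nat.pow_le_pow_right hLpos hk
        _ ≤ L ^ kk * L ^ m := Nat.le_mul_of_pos_right _ hw
    have hwR : (1 : ℝ) ≤ ((L ^ m : ℕ) : ℝ) := by exact_mod_cast hw
    have hnR : (1 : ℝ) ≤ ((L ^ kk : ℕ) : ℝ) := by exact_mod_cast hn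
    have hx : (1 : ℝ) ≤ (L : ℝ) ^ kk := one_le_pow₀ (by exact_mod_cast hL1)
    have hxcast : ((L ^ kk : ℕ) : ℝ) = (L : ℝ) ^ kk := Nat.cast_pow L kk
    -- the rate factors at the index, dominated by `θ = (L^k)^{−γ}`
    have hθ0 : 0 ≤ ((L : ℝ) ^ kk) ^ (-γ) := Real.rpow_nonneg (zero_le_one.trans hx) _
    have he16 : 0 ≤ ((L ^ kk : ℕ) : ℝ) ^ (-(1 / 8 / 2 : ℝ)) := Real.rpow_nonneg (Nat.cast_nonneg _) _
    have he16' : ((L ^ kk : ℕ) : ℝ) ^ (-(1 / 8 / 2 : ℝ)) ≤ ((L : ℝ) ^ kk) ^ (-γ) := by rw [hxcast]; exact Real.rpow_le_rpow_of_exponent_le hx (neg_le_neg hγ16)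
    have he8 : 0 ≤ ((L ^ kk : ℕ) : ℝ) ^ (-(1 / (8 * ((d : ℝ) + 1)))) := Real.rpow_nonneg (Nat.cast_nonneg _) _
    have he8' : ((L ^ kk : ℕ) : ℝ) ^ (-(1 / (8 * ((d : ℝ) + 1)))) ≤ ((L : ℝ) ^ kk) ^ (-γ) := by rw [hxcast]; exact Real.rpow_le_rpow_of_exponent_le hx (neg_le_neg hγ8)
    have heN' : ((L : ℝ) ^ kk) ^ (-γN) ≤ ((L : ℝ) ^ kk) ^ (-γ) := Real.rpow_le_rpow_of_exponent_le hx (neg_le_neg hγN')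
    have heN : 0 ≤ ((L : ℝ) ^ kk) ^ (-γN) := Real.rpow_nonneg (zero_le_one.trans hx) _
    have hε₁0 : 0 ≤ (((L ^ kk : ℕ) : ℝ) * ((L ^ m : ℕ) : ℝ))⁻¹ := by positivity
    have hε₁ : (((L ^ kk : ℕ) : ℝ) * ((L ^ m : ℕ) : ℝ))⁻¹ ≤ ((L : ℝ) ^ kk) ^ (-γ) := by
      calc (((L ^ kk : ℕ) : ℝ) * ((L ^ m : ℕ) : ℝ))⁻¹ ≤ (((L ^ kk : ℕ) : ℝ))⁻¹ := by
            rw [mul_inv]; exact mul_le_of_le_one_right (by positivity) (inv_le_one_of_one_le₀ hwR)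
        _ = ((L : ℝ) ^ kk) ^ (-(1 : ℝ)) := by rw [hxcast, Real.rpow_neg_one]
        _ ≤ ((L : ℝ) ^ kk) ^ (-γ) := Real.rpow_le_rpow_of_exponent_le hx (neg_le_neg hγ1)
    -- torus letters at both spacings, at the rate `δx`
    have Hk := (H (m + 1) kk r hk).1
    have Hk' := (H (m + 1) kk r hk).2
    have hG := (hasMaj_gOp_of_ineq (L := L) (k := kk) (MP (paramsOf d L (m + 1) kk hL)) (L ^ kk) a hn Hk hC.le).mono fun y y' => maj₀_weaken le_rfl hC.le dδ0 y y'
    have hG' := (hasMaj_gOp_of_ineq (L := L) (k := kk) (MP (paramsOf d L (m + 1) kk hL)) (L ^ r * L ^ kk) a hn' Hk' hC.le).mono fun y y' => maj₀_weaken le_rfl hC.le dδ0 y y'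
    have hNL := HL kk (L ^ kk) (MP (paramsOf d L (m + 1) kk hL))
    -- per cube: FILE 94's coarse row and FILE 97's defect
    have hblk : (fun x : Tor (fine (L ^ r * L ^ kk) (MP (paramsOf d L (m + 1) kk hL))) × Fin (d + 1) => blockOf (L ^ r * L ^ kk) (MP (paramsOf d L (m + 1) kk hL)) x.1) =
        (fun b : Tor (fine (L ^ kk) (MP (paramsOf d L (m + 1) kk hL))) × Fin (d + 1) => blockOf (L ^ kk) (MP (paramsOf d L (m + 1) kk hL)) b.1) ∘
          kingPrV L kk r (MP (paramsOf d L (m + 1) kk hL)) := (VectorPiece.blkFine_comp_kingPrV (M := MP (paramsOf d L (m + 1) kk hL)) L kk r).symm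
    have hKD : ∀ k : Fin (d + 1) → ZMod (2 * L),
        HasMaj (BlockNorm.ofBlocks (unitTorusGeo L kk (MP (paramsOf d L (m + 1) kk hL)))
            (fun b : Tor (fine (L ^ kk) (MP (paramsOf d L (m + 1) kk hL))) × Fin (d + 1) => blockOf (L ^ kk) (MP (paramsOf d L (m + 1) kk hL)) b.1))
          (BlockNorm.ofBlocks (unitTorusGeo L kk (MP (paramsOf d L (m + 1) kk hL)))
            (fun b : Tor (fine (L ^ kk) (MP (paramsOf d L (m + 1) kk hL))) × Fin (d + 1) => blockOf (L ^ kk) (MP (paramsOf d L (m + 1) kk hL)) b.1))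
          ((mulOp (chiCube (MP (paramsOf d L (m + 1) kk hL)) (L ^ kk) (coverCorner (MP (paramsOf d L (m + 1) kk hL)) (L ^ m) L (coverMargin L m) k) (L * L ^ m)) ∘ₗ
            knitG d L m kk (L ^ kk) hL a k) ∘ₗ commOp (deltaOp (MP (paramsOf d L (m + 1) kk hL)) (L ^ kk) a) (knitH d L m kk (L ^ kk) hL k))
          (fun y y' => ind ((cubeBlocks (MP (paramsOf d L (m + 1) kk hL)) (coverCorner (MP (paramsOf d L (m + 1) kk hL)) (L ^ m) L (coverMargin L m) k) (L * L ^ m) : Finset _) : Set _) y *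
            ((((d + 1 : ℕ) : ℝ) * (3 * (2 ^ (d + 1) * (C * Real.exp δx) * (32 * π ^ 2 / ((L ^ m : ℕ) : ℝ) ^ 2)) + 2 * (max βp βb * (π / ((L ^ m : ℕ) : ℝ)))) + 0 +
              2 ^ (d + 1) * (C * Real.exp δx) *
                ((π * (d + 1) / ((L ^ m : ℕ) : ℝ) * (Real.exp 1 * (min δx δ₁ / 4))⁻¹ + 2 * (π * (d + 1) / ((L ^ m : ℕ) : ℝ))) *
                  (|a| * (Real.exp (min δx δ₁) * Real.exp (min δx δ₁)) + C₁)) *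
                B4Sect5Proof.latticeConst (d + 1) (min δx δ₁ / 4)) *
              Real.exp (-(ρ * tdistT (MP (paramsOf d L (m + 1) kk hL)) y y')))) ∧
        HasMaj (BlockNorm.ofBlocks (unitTorusGeo L kk (MP (paramsOf d L (m + 1) kk hL)))
            (fun b : Tor (fine (L ^ kk) (MP (paramsOf d L (m + 1) kk hL))) × Fin (d + 1) => blockOf (L ^ kk) (MP (paramsOf d L (m + 1) kk hL)) b.1))
          (BlockNorm.ofBlocks (unitTorusGeo L kk (MP (paramsOf d L (m + 1) kk hL)))
            (fun x : Tor (fine (L ^ r * L ^ kk) (MP (paramsOf d L (m + 1) kk hL))) × Fin (d + 1) => blockOf (L ^ r * L ^ kk) (MP (paramsOf d L (m + 1) kk hL)) x.1))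
          (idef (pull (kingPrV L kk r (MP (paramsOf d L (m + 1) kk hL)))) (pull (kingPrV L kk r (MP (paramsOf d L (m + 1) kk hL))))
            ((mulOp (chiCube (MP (paramsOf d L (m + 1) kk hL)) (L ^ r * L ^ kk) (coverCorner (MP (paramsOf d L (m + 1) kk hL)) (L ^ m) L (coverMargin L m) k) (L * L ^ m)) ∘ₗ
                knitG d L m kk (L ^ r * L ^ kk) hL a k) ∘ₗ commOp (deltaOp (MP (paramsOf d L (m + 1) kk hL)) (L ^ r * L ^ kk) a) (knitH d L m kk (L ^ r * L ^ kk) hL k))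
            ((mulOp (chiCube (MP (paramsOf d L (m + 1) kk hL)) (L ^ kk) (coverCorner (MP (paramsOf d L (m + 1) kk hL)) (L ^ m) L (coverMargin L m) k) (L * L ^ m)) ∘ₗ
                knitG d L m kk (L ^ kk) hL a k) ∘ₗ commOp (deltaOp (MP (paramsOf d L (m + 1) kk hL)) (L ^ kk) a) (knitH d L m kk (L ^ kk) hL k)))
          (fun y y' => ind ((cubeBlocks (MP (paramsOf d L (m + 1) kk hL)) (coverCorner (MP (paramsOf d L (m + 1) kk hL)) (L ^ m) L (coverMargin L m) k) (L * L ^ m) : Finset _) : Set _) y *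
            (((Fintype.card (Fin (d + 1)) : ℝ) * (3 * (2 ^ (d + 1) * (C * Real.exp δx) *
                (((((L ^ m : ℕ) : ℝ)))⁻¹ ^ 2 * (((L ^ kk : ℕ) : ℝ) * ((L ^ m : ℕ) : ℝ))⁻¹ * (144 * π ^ 3 + 32 * π ^ 3 * Fintype.card (Fin (d + 1)))) +
                  mc * ((L ^ kk : ℕ) : ℝ) ^ (-(1 / 8 / 2 : ℝ)) * (32 * π ^ 2 / ((L ^ m : ℕ) : ℝ) ^ 2)) +
                2 * (max βp βb * (|((((L ^ m : ℕ) : ℝ)))⁻¹| * (((L ^ kk : ℕ) : ℝ) * ((L ^ m : ℕ) : ℝ))⁻¹ * (64 * π ^ 2 + π ^ 2 * Fintype.card (Fin (d + 1)))) +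
                  max mp mb * ((L ^ kk : ℕ) : ℝ) ^ (-(1 / (8 * ((d : ℝ) + 1)))) * (π / ((L ^ m : ℕ) : ℝ)))) + 0 + rN * ((L : ℝ) ^ kk) ^ (-γN)) *
              Real.exp (-(ρ * tdistT (MP (paramsOf d L (m + 1) kk hL)) y y')))) := fun k => by
      -- coarse right entries (FILE 94's row)
      have hTD : ∀ μ : Fin (d + 1), _ := fun μ => by
        have h := (HP (m + 1) kk r hk (coverCorner (MP (paramsOf d L (m + 1) kk hL)) (L ^ m) L (coverMargin L m) k) μ).1
        rw [hSe, symbOp_sD_eq] at h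
        exact h.mono fun y y' => maj₂_weaken (le_max_left βp βb) hβx dδp y y'
      have hTB : ∀ μ : Fin (d + 1), _ := fun μ => by
        have h := (HB (m + 1) kk r hk (coverCorner (MP (paramsOf d L (m + 1) kk hL)) (L ^ m) L (coverMargin L m) k) μ).1
        rw [hSe, symbOp_sTinv_sub_one_eq] at h
        exact h.mono fun y y' => maj₂_weaken (le_max_right βp βb) hβx dδb y y'
      have hK := hasMaj_chiCube_neumannCubeG_comp_commOp_deltaOp (L := L) (kk := kk) (n := L ^ kk) (q := L) (w := L ^ m) (m₀ := coverMargin L m) hM hw hfit1 k ha hC hδx hC₁.le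
        hδ₁ hβx hG hTD hTB hNL
      -- fine right entries and the defects (FILE 97's row)
      have hTD' : ∀ μ : Fin (d + 1), _ := fun μ => by
        have h := (HP (m + 1) kk r hk (coverCorner (MP (paramsOf d L (m + 1) kk hL)) (L ^ m) L (coverMargin L m) k) μ).2
        rw [hSe, symbOp_sD_eq] at h
        exact h.mono fun y y' => maj₂_weaken (le_max_left βp βb) hβx dδp y y'
      have hTB' : ∀ μ : Fin (d + 1), _ := fun μ => by
        have h := (HB (m + 1) kk r hk (coverCorner (MP (paramsOf d L (m + 1) kk hL)) (L ^ m) L (coverMargin L m) k) μ).2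
        rw [hSe, symbOp_sTinv_sub_one_eq] at h
        exact h.mono fun y y' => maj₂_weaken (le_max_right βp βb) hβx dδb y y'
      have hIG := by
        have h := HC (m + 1) kk r hk hL (coverCorner (MP (paramsOf d L (m + 1) kk hL)) (L ^ m) L (coverMargin L m) k)
        rw [hSe] at h
        exact h.mono fun y y' => maj₂_weaken (le_refl (mc * ((L ^ kk : ℕ) : ℝ) ^ (-(1 / 8 / 2 : ℝ)))) (mul_nonneg hmc.le he16) dδc y y'
      have hITD : ∀ μ : Fin (d + 1), _ := fun μ => by
        have h := HIP (m + 1) kk r hk hn4 hL (coverCorner (MP (paramsOf d L (m + 1) kk hL)) (L ^ m) L (coverMargin L m) k) μ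
        rw [hSe, symbOp_sD_eq, symbOp_sD_eq] at h
        exact h.mono fun y y' => maj₂_weaken (mul_le_mul_of_nonneg_right (le_max_left mp mb) he8) (mul_nonneg hmx he8) dδip y y'
      have hITB : ∀ μ : Fin (d + 1), _ := fun μ => by
        have h := HIB (m + 1) kk r hk hn4 hL (coverCorner (MP (paramsOf d L (m + 1) kk hL)) (L ^ m) L (coverMargin L m) k) μ
        rw [hSe, symbOp_sTinv_sub_one_eq, symbOp_sTinv_sub_one_eq] at h
        exact h.mono fun y y' => maj₂_weaken (mul_le_mul_of_nonneg_right (le_max_right mp mb) he8) (mul_nonneg hmx he8) dδib y y'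
      have hDNk := (HN m kk r hk hn4 k).mono fun y y' => maj₁_weaken (le_refl (rN * ((L : ℝ) ^ kk) ^ (-γN))) (mul_nonneg hrN heN) hρN y y'
      have hD := hasMaj_idef_chiCube_neumannCubeG_comp_commOp_deltaOp (L := L) (kk := kk) (r := r) (q := L) (w := L ^ m) (m₀ := coverMargin L m) hM hw hfit1 h3 k ha hC hδx
        hβx (mul_nonneg hmc.le he16) (mul_nonneg hmx he8) hρx hG' hTD' hTB' hIG hITD hITB hDNk
      refine ⟨hK.mono fun y y' => maj₁_weaken le_rfl ?_ hρK y y', hD⟩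
      positivity
    -- the cut, the overlap, the fit; FILE 57
    have hcut : ∀ k : Fin (d + 1) → ZMod (2 * L), mulOp (knitH d L m kk (L ^ kk) hL k) ∘ₗ
        mulOp (chiCube (MP (paramsOf d L (m + 1) kk hL)) (L ^ kk) (coverCorner (MP (paramsOf d L (m + 1) kk hL)) (L ^ m) L (coverMargin L m) k) (L * L ^ m)) =
        mulOp (knitH d L m kk (L ^ kk) hL k) := fun k =>
      hcube_cut (2 * L) (coverXi (MP (paramsOf d L (m + 1) kk hL)) (L ^ kk) (L ^ m)) (bshiftEquiv (MP (paramsOf d L (m + 1) kk hL)) (L ^ kk)) 0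
        (chiCube_coverCorner_eq_one_side (M := MP (paramsOf d L (m + 1) kk hL)) (n := L ^ kk) (m₀ := coverMargin L m) hM hw hfit1 hS 0 k)
    have hcut' : ∀ k : Fin (d + 1) → ZMod (2 * L), mulOp (knitH d L m kk (L ^ r * L ^ kk) hL k) ∘ₗ
        mulOp (chiCube (MP (paramsOf d L (m + 1) kk hL)) (L ^ r * L ^ kk) (coverCorner (MP (paramsOf d L (m + 1) kk hL)) (L ^ m) L (coverMargin L m) k) (L * L ^ m)) =
        mulOp (knitH d L m kk (L ^ r * L ^ kk) hL k) := fun k =>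
      hcube_cut (2 * L) (coverXi (MP (paramsOf d L (m + 1) kk hL)) (L ^ r * L ^ kk) (L ^ m)) (bshiftEquiv (MP (paramsOf d L (m + 1) kk hL)) (L ^ r * L ^ kk)) 0
        (chiCube_coverCorner_eq_one_side (M := MP (paramsOf d L (m + 1) kk hL)) (n := L ^ r * L ^ kk) (m₀ := coverMargin L m) hM hw hfit1 hS 0 k)
    have hh' : ∀ (k : Fin (d + 1) → ZMod (2 * L)) x', |knitH d L m kk (L ^ r * L ^ kk) hL k x'| ≤ 1 := fun k x' => abs_coverH_le_one k x'
    have hfitH : ∀ (k : Fin (d + 1) → ZMod (2 * L)) x', |knitH d L m kk (L ^ r * L ^ kk) hL k x' - knitH d L m kk (L ^ kk) hL k (kingPrV L kk r (MP (paramsOf d L (m + 1) kk hL)) x')| ≤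
        π * (d + 1) / (((L ^ kk : ℕ) : ℝ) * ((L ^ m : ℕ) : ℝ)) := fun k x' => abs_coverH_fine_sub_le (L := L) (kk := kk) (r := r) hM hw k x'
    have hN := fun y => sum_ind_cubeBlocks_le (M := MP (paramsOf d L (m + 1) kk hL)) (w := L ^ m) (q := L) (m₀ := coverMargin L m) L kk y
    have hΘw := rightRemainderConst_le (D := ((d + 1 : ℕ) : ℝ)) (Dr := (d : ℝ) + 1) (β := 2 ^ (d + 1) * (C * Real.exp δx)) (β₁ := max βp βb)
      (cN := |a| * (Real.exp (min δx δ₁) * Real.exp (min δx δ₁)) + C₁) (cr := B4Sect5Proof.latticeConst (d + 1) (min δx δ₁ / 4)) (E := Real.exp 1 * (min δx δ₁ / 4)) hwR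
      (by positivity) (by positivity)
    have hΘd := rightDefectConst_le (D := (Fintype.card (Fin (d + 1)) : ℝ)) (β := 2 ^ (d + 1) * (C * Real.exp δx)) (β₁ := max βp βb) (mc := mc) (mx := max mp mb) (rN := rN)
      (A₁ := 64 * π ^ 2 + π ^ 2 * Fintype.card (Fin (d + 1))) (A₂ := 144 * π ^ 3 + 32 * π ^ 3 * Fintype.card (Fin (d + 1))) (w := ((L ^ m : ℕ) : ℝ)) hwR (by positivity)
      (by positivity) hβx hmc.le hmx hrN (by positivity) (by positivity) hε₁0 hε₁ he16 he16' he8 he8' heN'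
    have hIR := hasMaj_idef_remainderL_out (g := unitTorusGeo L kk (MP (paramsOf d L (m + 1) kk hL)))
      (fun b : Tor (fine (L ^ kk) (MP (paramsOf d L (m + 1) kk hL))) × Fin (d + 1) => blockOf (L ^ kk) (MP (paramsOf d L (m + 1) kk hL)) b.1)
      (kingPrV L kk r (MP (paramsOf d L (m + 1) kk hL)))
      (fun k => ((cubeBlocks (MP (paramsOf d L (m + 1) kk hL)) (coverCorner (MP (paramsOf d L (m + 1) kk hL)) (L ^ m) L (coverMargin L m) k) (L * L ^ m) : Finset _) : Set _))
      (Δ := deltaOp (MP (paramsOf d L (m + 1) kk hL)) (L ^ kk) a) (Δ' := deltaOp (MP (paramsOf d L (m + 1) kk hL)) (L ^ r * L ^ kk) a)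
      (h := knitH d L m kk (L ^ kk) hL) (h' := knitH d L m kk (L ^ r * L ^ kk) hL)
      (G := fun k => mulOp (chiCube (MP (paramsOf d L (m + 1) kk hL)) (L ^ kk) (coverCorner (MP (paramsOf d L (m + 1) kk hL)) (L ^ m) L (coverMargin L m) k) (L * L ^ m)) ∘ₗ
        knitG d L m kk (L ^ kk) hL a k)
      (G' := fun k => mulOp (chiCube (MP (paramsOf d L (m + 1) kk hL)) (L ^ r * L ^ kk) (coverCorner (MP (paramsOf d L (m + 1) kk hL)) (L ^ m) L (coverMargin L m) k) (L * L ^ m)) ∘ₗ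
        knitG d L m kk (L ^ r * L ^ kk) hL a k)
      (r := ((Fintype.card (Fin (d + 1)) : ℝ) * (3 * (2 ^ (d + 1) * (C * Real.exp δx) * (((((L ^ m : ℕ) : ℝ)))⁻¹ ^ 2 * (((L ^ kk : ℕ) : ℝ) * ((L ^ m : ℕ) : ℝ))⁻¹ * (144 * π ^ 3 + 32 * π ^ 3 * Fintype.card (Fin (d + 1)))) + mc * ((L ^ kk : ℕ) : ℝ) ^ (-(1 / 8 / 2 : ℝ)) * (32 * π ^ 2 / ((L ^ m : ℕ) : ℝ) ^ 2)) + 2 * (max βp βb * (|((((L ^ m : ℕ) : ℝ)))⁻¹| * (((L ^ kk : ℕ) : ℝ) * ((L ^ m : ℕ) : ℝ))⁻¹ * (64 * π ^ 2 + π ^ 2 * Fintype.card (Fin (d + 1)))) + max mp mb * ((L ^ kk : ℕ) : ℝ) ^ (-(1 / (8 * ((d : ℝ) + 1)))) * (π / ((L ^ m : ℕ) : ℝ)))) + 0 + rN * ((L : ℝ) ^ kk) ^ (-γN)))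
      (by positivity) (by positivity) (by positivity) hh' hfitH hN (fun k => (hKD k).1) (fun k => by have h2 := (hKD k).2; rw [hblk] at h2; exact h2)
    have eC : remainderL (deltaOp (MP (paramsOf d L (m + 1) kk hL)) (L ^ kk) a) (knitH d L m kk (L ^ kk) hL) (knitG d L m kk (L ^ kk) hL a) =
        remainderL (deltaOp (MP (paramsOf d L (m + 1) kk hL)) (L ^ kk) a) (knitH d L m kk (L ^ kk) hL)
          (fun k => mulOp (chiCube (MP (paramsOf d L (m + 1) kk hL)) (L ^ kk) (coverCorner (MP (paramsOf d L (m + 1) kk hL)) (L ^ m) L (coverMargin L m) k) (L * L ^ m)) ∘ₗ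
            knitG d L m kk (L ^ kk) hL a k) := (remainderL_cut hcut).symm
    have eF : remainderL (deltaOp (MP (paramsOf d L (m + 1) kk hL)) (L ^ r * L ^ kk) a) (knitH d L m kk (L ^ r * L ^ kk) hL) (knitG d L m kk (L ^ r * L ^ kk) hL a) =
        remainderL (deltaOp (MP (paramsOf d L (m + 1) kk hL)) (L ^ r * L ^ kk) a) (knitH d L m kk (L ^ r * L ^ kk) hL)
          (fun k => mulOp (chiCube (MP (paramsOf d L (m + 1) kk hL)) (L ^ r * L ^ kk) (coverCorner (MP (paramsOf d L (m + 1) kk hL)) (L ^ m) L (coverMargin L m) k) (L * L ^ m)) ∘ₗ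
            knitG d L m kk (L ^ r * L ^ kk) hL a k) := (remainderL_cut hcut').symm
    erw [eC, eF, hblk]
    refine hIR.mono fun y y' => mul_le_mul_of_nonneg_right ?_ (Real.exp_nonneg _)
    -- the uniform constant
    have hΘw' := hΘw.trans (div_le_self (by positivity) hwR)
    have ho : π * (d + 1) / (((L ^ kk : ℕ) : ℝ) * ((L ^ m : ℕ) : ℝ)) ≤ π * (d + 1) * ((L : ℝ) ^ kk) ^ (-γ) := by
      rw [div_eq_mul_inv]; exact mul_le_mul_of_nonneg_left hε₁ (by positivity)
    have key := add_le_add hΘd (mul_le_mul ho hΘw' (by positivity) (by positivity))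
    refine (mul_le_mul_of_nonneg_left key hNov).trans (le_of_eq ?_)
    ring

end Knit

end Summit.QuantumFields.YangMills.BalabanUVNodes.N15.Gluing

end
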